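import Summits.FinalStateConjecture.FinalStateConjecture.Theorems.EIHFluxBalanceInertialRecessionStubRechart3Kinematics

/-!
# Route EIHFluxBalance — `InertialRecession`, re-charting: the inverse frame path

Helper file for the crux `stmt-FinalStateConjecture-10166`
(`Summit.FinalStateConjecture.FinalStateConjecture.Theses.EIHFluxBalance.InertialRecession`),
line `sublinear-is-free-clean-window-charges`, stub `stub_rechart` (the transfer P2), part G1.

The frame defect of a hole chart is read in the inverse frame `t ↦ (Λ̃ t)⁻¹`. This file shows that
the inverse of a smooth frame path is smooth (`contDiff_lorentz_symm`) and inherits the decay of all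
derivatives of orders `1, 2, 3` (`tendsto_iteratedDeriv_lorentz_symm`): inversion is the smooth map
`Ring.inverse` of the Banach algebra `E4 →L E4`, and a frame path of bounded Lorentz factor ranges
in the COMPACT set of Lorentz matrices of norm `≤ 4γ`, contained in the open set of units, so the
Faà di Bruno decay lemma of `…StubRechart3Frames` applies. [folklore]
-/

noncomputable section

set_option linter.dupNamespace false

open Set Filter Function Metric Topology
open scoped ContDiff
open Literature.Geometry.Lorentzian

namespace Summit.FinalStateConjecture.FinalStateConjecture.Theorems.SublinearIsFree.Rechart

/-- A Lorentz matrix (as an operator) is a unit of the operator algebra, with inverse the inverse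
Lorentz transformation. [folklore] -/
theorem ring_inverse_lorentz (Λ : lorentzGroup) :
    Ring.inverse ((Λ : E4 ≃L[ℝ] E4) : E4 →L[ℝ] E4) = (((Λ : E4 ≃L[ℝ] E4).symm : E4 ≃L[ℝ] E4) : E4 →L[ℝ] E4) := by
  have h := Ring.inverse_unit (ContinuousLinearEquiv.toUnit (Λ : E4 ≃L[ℝ] E4))
  exact h

/-- An operator preserving the Minkowski form is injective (`η` is nondegenerate). [folklore] -/
theorem injective_of_minkowski_invariant {X : E4 →L[ℝ] E4}
    (hX : ∀ v w, Minkowski.bilin (X v) (X w) = Minkowski.bilin v w) : Injective X := by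
  refine (injective_iff_map_eq_zero X).mpr fun v hv ↦ Minkowski.bilin_nondegenerate v fun w ↦ ?_
  rw [← hX v w, hv, map_zero, zero_apply]

/-- An operator preserving the Minkowski form is a unit of the operator algebra. [folklore] -/
theorem isUnit_of_minkowski_invariant {X : E4 →L[ℝ] E4}
    (hX : ∀ v w, Minkowski.bilin (X v) (X w) = Minkowski.bilin v w) : IsUnit X := by
  have hinj := injective_of_minkowski_invariant hX
  have hbij : Bijective (X : E4 →ₗ[ℝ] E4) := ⟨hinj, LinearMap.injective_iff_surjective.mp hinj⟩
  let e : E4 ≃L[ℝ] E4 := (LinearEquiv.ofBijective (X : E4 →ₗ[ℝ] E4) hbij).toContinuousLinearEquiv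
  have he : ((e : E4 ≃L[ℝ] E4) : E4 →L[ℝ] E4) = X := by ext v; rfl
  have hu := (ContinuousLinearEquiv.toUnit e).isUnit
  exact he ▸ hu

/-- **The set of Lorentz matrices of norm at most `C` is compact** (closed and bounded in the
finite-dimensional operator space). [folklore] -/
theorem isCompact_lorentzBall (C : ℝ) :
    IsCompact {X : E4 →L[ℝ] E4 | ‖X‖ ≤ C ∧ ∀ v w, Minkowski.bilin (X v) (X w) = Minkowski.bilin v w} := by
  have hset : {X : E4 →L[ℝ] E4 | ‖X‖ ≤ C ∧ ∀ v w, Minkowski.bilin (X v) (X w) = Minkowski.bilin v w} =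
      {X | ‖X‖ ≤ C} ∩ ⋂ v : E4, ⋂ w : E4, {X | Minkowski.bilin (X v) (X w) = Minkowski.bilin v w} := by
    ext X; simp
  rw [hset]
  haveI : ProperSpace (E4 →L[ℝ] E4) := FiniteDimensional.proper ℝ (E4 →L[ℝ] E4)
  refine Metric.isCompact_of_isClosed_isBounded ?_ ?_
  · refine (isClosed_le continuous_norm continuous_const).inter ?_
    exact isClosed_iInter fun v ↦ isClosed_iInter fun w ↦ isClosed_eq (by fun_prop) continuous_const
  · exact (Metric.isBounded_closedBall (x := (0 : E4 →L[ℝ] E4)) (r := C)).subset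
      fun X hX ↦ by simpa using hX.1

section Path

variable (Λ : ℝ → lorentzGroup)
  (hΛ : ContDiff ℝ ∞ (fun t ↦ ((Λ t : E4 ≃L[ℝ] E4) : E4 →L[ℝ] E4)))
  (hdec : ∀ m, 1 ≤ m → m ≤ 3 → Tendsto (fun t ↦ iteratedDeriv m
    (fun s ↦ ((Λ s : E4 ≃L[ℝ] E4) : E4 →L[ℝ] E4)) t) atTop (𝓝 0))
  {γ : ℝ} (hγ : ∀ t, |((Λ t : E4 ≃L[ℝ] E4) (E4.basisVector 0)) 0| ≤ γ)

/-- The inverse frame path is `Ring.inverse` of the frame path. [folklore] -/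
theorem lorentz_symm_eq_ring_inverse :
    (fun t ↦ (((Λ t : E4 ≃L[ℝ] E4).symm : E4 ≃L[ℝ] E4) : E4 →L[ℝ] E4)) =
      fun t ↦ Ring.inverse ((Λ t : E4 ≃L[ℝ] E4) : E4 →L[ℝ] E4) :=
  funext fun t ↦ (ring_inverse_lorentz (Λ t)).symm

include hΛ in
/-- **The inverse frame path is smooth.** [folklore] -/
theorem contDiff_lorentz_symm :
    ContDiff ℝ ∞ (fun t ↦ (((Λ t : E4 ≃L[ℝ] E4).symm : E4 ≃L[ℝ] E4) : E4 →L[ℝ] E4)) := by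
  rw [lorentz_symm_eq_ring_inverse]
  refine contDiff_iff_contDiffAt.mpr fun t ↦ ?_
  have hu : IsUnit ((Λ t : E4 ≃L[ℝ] E4) : E4 →L[ℝ] E4) := isUnit_of_minkowski_invariant (Λ t).2
  have h := contDiffAt_ringInverse ℝ hu.unit (n := ∞)
  rw [IsUnit.unit_spec] at h
  exact h.comp t hΛ.contDiffAt

include hΛ hdec hγ in
/-- **The inverse frame path inherits the decay of all derivatives.** [folklore] -/
theorem tendsto_iteratedDeriv_lorentz_symm : ∀ m, 1 ≤ m → m ≤ 3 →
    Tendsto (fun t ↦ iteratedDeriv m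
      (fun s ↦ (((Λ s : E4 ≃L[ℝ] E4).symm : E4 ≃L[ℝ] E4) : E4 →L[ℝ] E4)) t) atTop (𝓝 0) := by
  rw [lorentz_symm_eq_ring_inverse]
  set K : Set (E4 →L[ℝ] E4) := {X | ‖X‖ ≤ 1 + 3 * γ ∧ ∀ v w, Minkowski.bilin (X v) (X w) = Minkowski.bilin v w}
    with hK
  have hO : IsOpen {X : E4 →L[ℝ] E4 | IsUnit X} := Units.isOpen
  have hKO : K ⊆ {X : E4 →L[ℝ] E4 | IsUnit X} := fun X hX ↦ isUnit_of_minkowski_invariant hX.2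
  have hg : ContDiffOn ℝ ∞ (Ring.inverse : (E4 →L[ℝ] E4) → E4 →L[ℝ] E4) {X | IsUnit X} := fun X hX ↦ by
    have h := contDiffAt_ringInverse ℝ hX.unit (n := ∞)
    rw [IsUnit.unit_spec] at h
    exact h.contDiffWithinAt
  have hwK : ∀ t, ((Λ t : E4 ≃L[ℝ] E4) : E4 →L[ℝ] E4) ∈ K := fun t ↦
    ⟨(norm_lorentz_le (Λ t)).trans (by linarith [hγ t]), (Λ t).2⟩
  exact tendsto_iteratedDeriv_comp_of_isCompact hO (isCompact_lorentzBall _) hKO hg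
    (hΛ.of_le (WithTop.coe_le_coe.mpr le_top)) hwK hdec

include hγ in
/-- `‖(Λ̃ t)⁻¹‖ ≤ 4γ` (the inverse has the same Lorentz factor). [folklore] -/
theorem norm_lorentz_symm_le_four_mul (t : ℝ) :
    ‖(((Λ t : E4 ≃L[ℝ] E4).symm : E4 ≃L[ℝ] E4) : E4 →L[ℝ] E4)‖ ≤ 4 * γ :=
  (norm_lorentz_symm_le (Λ t)).trans (by linarith [hγ t, one_le_abs_lorentz_apply_zero (Λ t)])

end Path

/-- Registered one-line form (worker carrier `rechart_ring_inverse_lorentz`). [folklore] -/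
theorem rechart_ring_inverse_lorentz : open Literature.Geometry.Lorentzian in ∀ (Λ : lorentzGroup), Ring.inverse ((Λ : E4 ≃L[ℝ] E4) : E4 →L[ℝ] E4) = (((Λ : E4 ≃L[ℝ] E4).symm : E4 ≃L[ℝ] E4) : E4 →L[ℝ] E4) := ring_inverse_lorentz

end Summit.FinalStateConjecture.FinalStateConjecture.Theorems.SublinearIsFree.Rechart

end
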